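import Summits.AnomalousDissipation.AnomalousDissipation.Theses.SteadyWeakLimit
import Literature.Analysis.FunctionSpaces.TorusCalculusProofs

/-!
# Route SteadyWeakLimit — typed decomposition of the crux `SteadyWeakRealisation`

Crux-strategist split (unit `cstrat-stmt-AnomalousDissipation-1303-r1`, BC2 redirect) of the deciding
crux `X = SteadyWeakRealisation` (stmt-AnomalousDissipation-1303) of route SteadyWeakLimit into two
pieces, cut along the classical "existence with slack / removal of the slack by stability" seam, with
the slack calibrated at the one scale the steady Navier–Stokes system singles out — the viscous one:

* **A = `SteadyRealisationSubviscousForce`** (constructive side). Steady smooth forces `fs j`,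
  steady classical states `(u j, p j)` of `NS_{ν j}(fs j)`, `ν j → 0+`, bounded energy, `u j ⇀ v`
  weakly in `L²` with `∫ ⟪f, v⟫ > 0`, and a SUB-VISCOUS force defect
  `‖fs j - f‖_{L²} ≤ δ j · ν j`, `δ j → 0`. It sits strictly between the route's items:
  `X ⇒ A` (`fs j = f`, `δ = 0`; `steadyRealisationSubviscousForce_of_steadyWeakRealisation`) and
  `A ⇒ SteadyRealisationAsymptoticForce` (stmt-1304, `o(1)` defect in `L²`;
  `steadyRealisationAsymptoticForce_of_subviscous`).
* **B = `SubviscousDefectAbsorption`** (rigidity side, universal). Every bounded-energy family of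
  steady classical states whose force defect from a fixed smooth `f` is sub-viscous is weakly
  shadowed, along a subsequence, by bounded-energy steady classical states of the EXACT force `f`
  (at some viscosities `ν' j → 0+`): `u' j - u (φ j) ⇀ 0` against smooth fields. The threshold is
  sharp: an `O(ν)` defect is NOT absorbable (f = 0, `u j = v` a fixed Beltrami field, which solves
  `NS_ν` with force `ν λ² v`, while the bounded steady states of the zero force are the constants),
  and for `f = 0` the sub-viscous statement holds (energy identity: `‖∇u j‖² ≤ δ j √E → 0`).

`steadyWeakRealisation_of_subs : A → B → X` is the assembly: apply B to A's family, then transfer the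
weak limit through the shadowing (`∫ ⟪w, u' j⟫ = ∫ ⟪w, u' j - u (φ j)⟫ + ∫ ⟪w, u (φ j)⟫ → 0 + ∫ ⟪w, v⟫`,
integrability from the smoothness of classical states) and carry the positivity of the injection.
The two pieces are stated here with their bodies expanded (they become route decls through
`ledger route edit --split`); no definitions are introduced in this file.
-/

namespace Summit.AnomalousDissipation.AnomalousDissipation.Cruxes.SteadyWeakRealisation.SubviscousSplit

-- crux workfile copy (Cruxes namespace) of the candidate Theorems file SteadyWeakLimitSteadyWeakRealisationSplit.lean
set_option linter.dupNamespace false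

open MeasureTheory Filter Topology
open scoped InnerProductSpace ENNReal
open Literature.Analysis.FunctionSpaces Literature.Analysis.FunctionSpaces.Torus
open Summit.AnomalousDissipation.AnomalousDissipation.Theses.SteadyWeakLimit

/-- **Assembly of the split `A → B → X`** (crux `SteadyWeakRealisation`, stmt-AnomalousDissipation-1303):
a steady realisation with SUB-VISCOUS force defect (`‖fs j - f‖_{L²} ≤ δ j · ν j`, `δ j → 0`; piece A,
`SteadyRealisationSubviscousForce`) together with the absorption principle for sub-viscous defects
(piece B, `SubviscousDefectAbsorption`: such families are weakly shadowed along a subsequence by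
bounded-energy steady states of the exact force) gives the steady weak realisation at FIXED force:
the shadowing family has the same weak limit `v` (`∫ ⟪w, u' j⟫ = ∫ ⟪w, u' j - u (φ j)⟫ + ∫ ⟪w, u (φ j)⟫`),
and `∫ ⟪f, v⟫ > 0` is inherited. -/
theorem steadyWeakRealisation_of_subs :
    (∃ (f v : UnitAddTorus (Fin 3) → EuclideanSpace ℝ (Fin 3)) (ν δ : ℕ → ℝ) (fs u : ℕ → UnitAddTorus (Fin 3) → EuclideanSpace ℝ (Fin 3)) (p : ℕ → UnitAddTorus (Fin 3) → ℝ), Literature.Analysis.FunctionSpaces.Torus.IsSmooth f ∧ Literature.Analysis.FunctionSpaces.Torus.IsDivFree f ∧ Literature.Analysis.FunctionSpaces.Torus.HasZeroMean f ∧ (∀ j, 0 < ν j) ∧ Filter.Tendsto ν Filter.atTop (nhds 0) ∧ (∀ j, Literature.Analysis.FunctionSpaces.Torus.IsSmooth (fs j) ∧ Literature.Analysis.FunctionSpaces.Torus.IsDivFree (fs j) ∧ Literature.Analysis.FunctionSpaces.Torus.HasZeroMean (fs j)) ∧ Filter.Tendsto δ Filter.atTop (nhds 0) ∧ (∀ j,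 MeasureTheory.eLpNorm (fs j - f) 2 MeasureTheory.volume ≤ ENNReal.ofReal (δ j * ν j)) ∧ (∀ j, Literature.Analysis.FunctionSpaces.Torus.IsClassicalNSSolutionOn Set.univ (ν j) (fun _ => fs j) (fun _ => u j) (fun _ => p j)) ∧ (∃ E : ℝ, ∀ j, MeasureTheory.integral MeasureTheory.volume (fun x => ‖u j x‖ ^ 2) ≤ E) ∧ MeasureTheory.MemLp v 2 MeasureTheory.volume ∧ (∀ w : UnitAddTorus (Fin 3) → EuclideanSpace ℝ (Fin 3), Literature.Analysis.FunctionSpaces.Torus.IsSmooth w → Filter.Tendsto (fun j => MeasureTheory.integral MeasureTheory.volume (fun x => inner ℝ (w x) (u j x))) Filter.atTop (nhds (MeasureTheory.integral MeasureTheory.volume (fun x => inner ℝ (w x) (v x))))) ∧ 0 < MeasureTheory.integral MeasureTheory.volume (fun x => inner ℝ (f x) (v x))) →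
    (∀ (f : UnitAddTorus (Fin 3) → EuclideanSpace ℝ (Fin 3)) (ν δ : ℕ → ℝ) (fs u : ℕ → UnitAddTorus (Fin 3) → EuclideanSpace ℝ (Fin 3)) (p : ℕ → UnitAddTorus (Fin 3) → ℝ) (E : ℝ), Literature.Analysis.FunctionSpaces.Torus.IsSmooth f → Literature.Analysis.FunctionSpaces.Torus.IsDivFree f → Literature.Analysis.FunctionSpaces.Torus.HasZeroMean f → (∀ j, 0 < ν j) → Filter.Tendsto ν Filter.atTop (nhds 0) → (∀ j, Literature.Analysis.FunctionSpaces.Torus.IsSmooth (fs j) ∧ Literature.Analysis.FunctionSpaces.Torus.IsDivFree (fs j) ∧ Literature.Analysis.FunctionSpaces.Torus.HasZeroMean (fs j)) → Filter.Tendsto δ Filter.atTop (nhds 0) → (∀ j, MeasureTheory.eLpNorm (fs j - f) 2 MeasureTheory.volume ≤ ENNReal.ofReal (δ j * ν j)) → (∀ j, Literature.Analysis.FunctionSpaces.Torus.IsClassicalNSSolutionOn Set.univ (ν j) (fun _ => fs j) (fun _ => u j) (fun _ => p j)) → (∀ j, MeasureTheory.integral MeasureTheory.volume (fun x => ‖u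 j x‖ ^ 2) ≤ E) → ∃ (φ : ℕ → ℕ) (ν' : ℕ → ℝ) (u' : ℕ → UnitAddTorus (Fin 3) → EuclideanSpace ℝ (Fin 3)) (p' : ℕ → UnitAddTorus (Fin 3) → ℝ) (E' : ℝ), StrictMono φ ∧ (∀ j, 0 < ν' j) ∧ Filter.Tendsto ν' Filter.atTop (nhds 0) ∧ (∀ j, Literature.Analysis.FunctionSpaces.Torus.IsClassicalNSSolutionOn Set.univ (ν' j) (fun _ => f) (fun _ => u' j) (fun _ => p' j)) ∧ (∀ j, MeasureTheory.integral MeasureTheory.volume (fun x => ‖u' j x‖ ^ 2) ≤ E') ∧ ∀ w : UnitAddTorus (Fin 3) → EuclideanSpace ℝ (Fin 3), Literature.Analysis.FunctionSpaces.Torus.IsSmooth w → Filter.Tendsto (fun j => MeasureTheory.integral MeasureTheory.volume (fun x => inner ℝ (w x) (u' j x - u (φ j) x))) Filter.atTop (nhds 0)) →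
    SteadyWeakRealisation := by
  intro hA hB
  obtain ⟨f, v, ν, δ, fs, u, p, hf, hdf, hmf, hν, hν0, hfs, hδ, hdef, hNS, ⟨E, hE⟩, hv, hweak, hpos⟩ :=
    hA
  obtain ⟨φ, ν', u', p', E', hφ, hν', hν'0, hNS', hE', hsh⟩ :=
    hB f ν δ fs u p E hf hdf hmf hν hν0 hfs hδ hdef hNS hE
  refine ⟨f, hf, hdf, hmf, ν', u', p', v, hν', hν'0, hNS', ⟨E', hE'⟩, hv, ?_, hpos⟩
  intro w hw
  -- the states are smooth (time slices of jointly smooth space–time fields)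
  have hu : ∀ j, IsSmooth (u j) := fun j =>
    (hNS j).smooth_velocity.isSmooth_slice (Set.mem_univ (0 : ℝ))
  have hu' : ∀ j, IsSmooth (u' j) := fun j =>
    (hNS' j).smooth_velocity.isSmooth_slice (Set.mem_univ (0 : ℝ))
  -- splitting `∫ ⟪w, u' j⟫ = ∫ ⟪w, u' j - u (φ j)⟫ + ∫ ⟪w, u (φ j)⟫`
  have hsplit : ∀ j, ∫ x, ⟪w x, u' j x⟫_ℝ =
      (∫ x, ⟪w x, u' j x - u (φ j) x⟫_ℝ) + ∫ x, ⟪w x, u (φ j) x⟫_ℝ := by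
    intro j
    have i1 : Integrable (fun x => ⟪w x, u' j x - u (φ j) x⟫_ℝ) :=
      (hw.inner ((hu' j).sub (hu (φ j)))).integrable
    have i2 : Integrable (fun x => ⟪w x, u (φ j) x⟫_ℝ) := (hw.inner (hu (φ j))).integrable
    rw [← integral_add i1 i2]
    refine integral_congr_ae (ae_of_all _ fun x => ?_)
    show ⟪w x, u' j x⟫_ℝ = ⟪w x, u' j x - u (φ j) x⟫_ℝ + ⟪w x, u (φ j) x⟫_ℝ
    rw [inner_sub_right]
    ring
  -- the shadowing term tends to `0`, the subsequence of the original pairings to `∫ ⟪w, v⟫`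
  have h1 : Tendsto (fun j => ∫ x, ⟪w x, u' j x - u (φ j) x⟫_ℝ) atTop (𝓝 0) := hsh w hw
  have h2 : Tendsto (fun j => ∫ x, ⟪w x, u (φ j) x⟫_ℝ) atTop (𝓝 (∫ x, ⟪w x, v x⟫_ℝ)) :=
    (hweak w hw).comp hφ.tendsto_atTop
  have h3 := h1.add h2
  rw [zero_add] at h3
  exact h3.congr fun j => (hsplit j).symm

/-- **`X ⇒ A`: piece A is a necessary condition for the crux.** A steady weak realisation at fixed
force `f` is in particular one with sub-viscous force defect: take `fs j = f` and `δ = 0`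
(`‖f - f‖_{L²} = 0 ≤ 0 · ν j`). Records the ledger edge `SteadyWeakRealisation ⇒
SteadyRealisationSubviscousForce` (so A is at most as strong as X). -/
theorem steadyRealisationSubviscousForce_of_steadyWeakRealisation :
    SteadyWeakRealisation →
    (∃ (f v : UnitAddTorus (Fin 3) → EuclideanSpace ℝ (Fin 3)) (ν δ : ℕ → ℝ) (fs u : ℕ → UnitAddTorus (Fin 3) → EuclideanSpace ℝ (Fin 3)) (p : ℕ → UnitAddTorus (Fin 3) → ℝ), Literature.Analysis.FunctionSpaces.Torus.IsSmooth f ∧ Literature.Analysis.FunctionSpaces.Torus.IsDivFree f ∧ Literature.Analysis.FunctionSpaces.Torus.HasZeroMean f ∧ (∀ j, 0 < ν j) ∧ Filter.Tendsto ν Filter.atTop (nhds 0) ∧ (∀ j, Literature.Analysis.FunctionSpaces.Torus.IsSmooth (fs j) ∧ Literature.Analysis.FunctionSpaces.Torus.IsDivFree (fs j) ∧ Literature.Analysis.FunctionSpaces.Torus.HasZeroMean (fs j)) ∧ Filter.Tendsto δ Filter.atTop (nhds 0) ∧ (∀ j, MeasureTheory.eLpNorm (fs j - f) 2 MeasureTheory.volume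 ≤ ENNReal.ofReal (δ j * ν j)) ∧ (∀ j, Literature.Analysis.FunctionSpaces.Torus.IsClassicalNSSolutionOn Set.univ (ν j) (fun _ => fs j) (fun _ => u j) (fun _ => p j)) ∧ (∃ E : ℝ, ∀ j, MeasureTheory.integral MeasureTheory.volume (fun x => ‖u j x‖ ^ 2) ≤ E) ∧ MeasureTheory.MemLp v 2 MeasureTheory.volume ∧ (∀ w : UnitAddTorus (Fin 3) → EuclideanSpace ℝ (Fin 3), Literature.Analysis.FunctionSpaces.Torus.IsSmooth w → Filter.Tendsto (fun j => MeasureTheory.integral MeasureTheory.volume (fun x => inner ℝ (w x) (u j x))) Filter.atTop (nhds (MeasureTheory.integral MeasureTheory.volume (fun x => inner ℝ (w x) (v x))))) ∧ 0 < MeasureTheory.integral MeasureTheory.volume (fun x => inner ℝ (f x) (v x))) := by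
  rintro ⟨f, hf, hdf, hmf, ν, u, p, v, hν, hν0, hNS, hE, hv, hweak, hpos⟩
  refine ⟨f, v, ν, fun _ => 0, fun _ => f, u, p, hf, hdf, hmf, hν, hν0, fun _ => ⟨hf, hdf, hmf⟩,
    tendsto_const_nhds, fun j => ?_, hNS, hE, hv, hweak, hpos⟩
  simp

/-- **`A ⇒ SteadyRealisationAsymptoticForce` (stmt-AnomalousDissipation-1304): piece A is at least as
strong as the route's rank-3 crux.** A sub-viscous defect `‖fs j - f‖_{L²} ≤ δ j · ν j` with `δ j → 0`
and `ν j → 0` is in particular an `o(1)` defect in `L²` (squeeze in `ℝ≥0∞`). Records the ledger edge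
`SteadyRealisationSubviscousForce ⇒ SteadyRealisationAsymptoticForce`. -/
theorem steadyRealisationAsymptoticForce_of_subviscous :
    (∃ (f v : UnitAddTorus (Fin 3) → EuclideanSpace ℝ (Fin 3)) (ν δ : ℕ → ℝ) (fs u : ℕ → UnitAddTorus (Fin 3) → EuclideanSpace ℝ (Fin 3)) (p : ℕ → UnitAddTorus (Fin 3) → ℝ), Literature.Analysis.FunctionSpaces.Torus.IsSmooth f ∧ Literature.Analysis.FunctionSpaces.Torus.IsDivFree f ∧ Literature.Analysis.FunctionSpaces.Torus.HasZeroMean f ∧ (∀ j, 0 < ν j) ∧ Filter.Tendsto ν Filter.atTop (nhds 0) ∧ (∀ j, Literature.Analysis.FunctionSpaces.Torus.IsSmooth (fs j) ∧ Literature.Analysis.FunctionSpaces.Torus.IsDivFree (fs j) ∧ Literature.Analysis.FunctionSpaces.Torus.HasZeroMean (fs j)) ∧ Filter.Tendsto δ Filter.atTop (nhds 0) ∧ (∀ j, MeasureTheory.eLpNorm (fs j - f) 2 MeasureTheory.volume ≤ ENNReal.ofReal (δ j * ν j)) ∧ (∀ j, Literature.Analysis.FunctionSpaces.Torus.IsClassicalNSSolutionOn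 Set.univ (ν j) (fun _ => fs j) (fun _ => u j) (fun _ => p j)) ∧ (∃ E : ℝ, ∀ j, MeasureTheory.integral MeasureTheory.volume (fun x => ‖u j x‖ ^ 2) ≤ E) ∧ MeasureTheory.MemLp v 2 MeasureTheory.volume ∧ (∀ w : UnitAddTorus (Fin 3) → EuclideanSpace ℝ (Fin 3), Literature.Analysis.FunctionSpaces.Torus.IsSmooth w → Filter.Tendsto (fun j => MeasureTheory.integral MeasureTheory.volume (fun x => inner ℝ (w x) (u j x))) Filter.atTop (nhds (MeasureTheory.integral MeasureTheory.volume (fun x => inner ℝ (w x) (v x))))) ∧ 0 < MeasureTheory.integral MeasureTheory.volume (fun x => inner ℝ (f x) (v x))) →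
    SteadyRealisationAsymptoticForce := by
  rintro ⟨f, v, ν, δ, fs, u, p, hf, hdf, hmf, hν, hν0, hfs, hδ, hdef, hNS, hE, hv, hweak, hpos⟩
  refine ⟨f, v, ν, fs, u, p, hf, hdf, hmf, hν, hν0, hfs, ?_, hNS, hE, hv, hweak, hpos⟩
  -- `‖fs j - f‖_{L²} ≤ ofReal (δ j * ν j) → 0` in `ℝ≥0∞`
  have hprod : Tendsto (fun j => δ j * ν j) atTop (𝓝 0) := by
    simpa using hδ.mul hν0
  have hup : Tendsto (fun j => ENNReal.ofReal (δ j * ν j)) atTop (𝓝 0) := by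
    simpa using ENNReal.tendsto_ofReal hprod
  exact tendsto_of_tendsto_of_tendsto_of_le_of_le tendsto_const_nhds hup (fun _ => bot_le) hdef

end Summit.AnomalousDissipation.AnomalousDissipation.Cruxes.SteadyWeakRealisation.SubviscousSplit
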